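import Summits.CriticalPhenomena.PercolationContinuityZ3.Theorems.PercNearOneGluingNoHeavyLowerTailThreePointProductFormFibreApexTransfer
import HarnessLib

/-!
# The product form `#bad² ≤ #P1·#P2` in the fibre language: A TWO-TERMINAL NETWORK HUNG AT A TERMINAL
# (Sahi programme, prover prim-sahi-p2 gen 55)

Support file (`--supports stmt-CriticalPhenomena-4575`, helper); continues `…ThreePointProductFormFibreApexTransfer` (reduction R1).  Standard
axioms, no sorries, no named facts, no definitions.  Memo `run/shared/lean/prim/prim-sahi/FROM-prim-sahi-p2-gen55-REDUCTIONS.md` §2 (reduction R3).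
SETTING.  A cut vertex `u ∉ W` separates the NETWORK SIDE `W ∋ s` from the rest (every label inside `W ∪ {u}` or inside `Wᶜ ∪ {u}`); the apex `a`
and the terminal `c` lie outside `W ∪ {u}`: the terminal `s` hangs off `u` through an arbitrary two-terminal network.  `R z x y` = open connection,
`♭ₓz = clusterFlip ends x z̄`.  Events: network side `Cn = {u ↔ s}`, `Dn = {u ↮ s}`, `Vn = {u ↮ s in z, u ↔ s in ♭ᵤz}`; far side, terminals
`(u, a, c)` with apex `a`: `B = {a ↮ u, a ↮ c, u ↮ c in z, u ↔ c in ♭ₐz}`, `Q1 = {a ↔ u, a ↮ c}`, `Q2 = {a ↔ c, a ↮ u}`, `J = {a ↔ c, a ↔ u}`,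
and the NEW event `Wt = {a ↔ u, a ↮ c in z, u ↔ c in ♭ₐz}`.
* `bad_iff_network`, `sa_iff_network`, `ac_iff_network` [this work] — POINTWISE: `bad(s,a,c) = (Cn ∩ B) ⊔ (Vn ∩ Wt)`, `P1 = Cn ∩ Q1`,
  `P2 = Q2 ⊔ (Dn ∩ J)`; hence (independence count) `#bad·#univ = #Cn·#B + #Vn·#Wt`, `#P1·#univ = #Cn·#Q1`, `#P2·#univ = #Q2·#univ + #Dn·#J`.
* `network_arith` [this work] — `B² ≤ Q1·Q2`, `(B + Wt)² ≤ Q1·(2·Q2 + J)`, `Vn ≤ min(Cn, Dn)` ⟹ `(Cn·B + Vn·Wt)² ≤ Cn·Q1·(Q2·(Cn+Dn) + Dn·J)`.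
* **`productForm_of_terminalNetwork`** [this work] — REDUCTION R3: `(P)` for `(u, a, c)` and its PENDANT-EDGE FORM `(#B + #Wt)² ≤ #Q1·(2·#Q2 + #J)`
  (= `(P)` for the far side plus one pendant label at `u`, where `Cn = Dn = Vn`) imply `(P)` for `(s, a, c)`, for EVERY network, using only the
  two-point facts `#Vn ≤ #Cn`, `#Vn ≤ #Dn` (`…FibreFlat`).  So in a minimal counterexample to CONJECTURE (P) every network hung at a terminal is
  one pendant label; with R1, the cut-vertex theorem and the hanging parts, the trunk is 2-connected (memo §0).
[folklore] (walks through a cut vertex; product counting); [cite: Gladkov2024, Conjecture 10.1 (p. 18), arXiv:2408.08457] for CONJECTURE (P).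
-/

namespace Summit.CriticalPhenomena.PercolationContinuityZ3.Theorems.ProductFormFibre

open Finset Literature.Probability.Percolation
open Summit.CriticalPhenomena.PercolationContinuityZ3.Theorems.ThreePointCPIClusterSwap
  (QTouch clusterFlip clusterFlip_of_qtouch clusterFlip_of_not_qtouch)

variable {V α : Type*}

/-! ### 1. The flat of an outside apex on outside labels -/

section OutsideFlat

variable [DecidableEq V] (ends : α → Sym2 V) (u : V) (W : Set V)

/-- **The flat at an apex outside `W` respects the separation on the outside**: if `z, z'` agree on the non-loop labels outside `W`, then for
`a ∉ W ∪ {u}` the flats `♭ₐz, ♭ₐz'` agree on those labels. [this work] -/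
theorem flat_apply_eq_of_agree_outside
    (hsep : ∀ l : α, (∀ v ∈ ends l, v ∈ W ∨ v = u) ∨ (∀ v ∈ ends l, v ∉ W ∨ v = u)) (huW : u ∉ W)
    {z z' : α → Bool}
    (hagree : ∀ l, (∀ v ∈ ends l, v ∈ {v : V | v ∉ W ∧ v ≠ u} ∨ v = u) → ¬ (ends l).IsDiag → z l = z' l)
    {a : V} (ha : a ∈ {v : V | v ∉ W ∧ v ≠ u} ∨ a = u)
    {l : α} (hl : ∀ v ∈ ends l, v ∈ {v : V | v ∉ W ∧ v ≠ u} ∨ v = u) (hd : ¬ (ends l).IsDiag) :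
    clusterFlip ends a (fun x => !z x) l = clusterFlip ends a (fun x => !z' x) l := by
  classical
  have hq : QTouch ends a (fun x => !z x) l ↔ QTouch ends a (fun x => !z' x) l := by
    rw [qtouch_compl_iff, qtouch_compl_iff]
    constructor
    · rintro ⟨v, hv, hr⟩
      exact ⟨v, hv, (reachable_iff_of_agree_outside ends u W hsep huW hagree ha (hl v hv)).1 hr⟩
    · rintro ⟨v, hv, hr⟩
      exact ⟨v, hv, (reachable_iff_of_agree_outside ends u W hsep huW hagree ha (hl v hv)).2 hr⟩
  by_cases h : QTouch ends a (fun x => !z x) l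
  · rw [clusterFlip_of_qtouch ends a _ h, clusterFlip_of_qtouch ends a _ (hq.1 h)]
    simp only [hagree l hl hd]
  · rw [clusterFlip_of_not_qtouch ends a _ h, clusterFlip_of_not_qtouch ends a _ (fun h' => h (hq.2 h'))]
    simp only [Bool.not_not, hagree l hl hd]

/-- If the outside apex `a` is not joined to the cut vertex, its flat does not change the non-loop labels of the network side
(`flat_apply_eq_self_of_not_reachable` read from the other side of the cut vertex). [this work] -/
theorem flat_apply_eq_self_inside_of_not_reachable
    (hsep : ∀ l : α, (∀ v ∈ ends l, v ∈ W ∨ v = u) ∨ (∀ v ∈ ends l, v ∉ W ∨ v = u)) (huW : u ∉ W)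
    {a : V} (haW : a ∉ W) (hau : a ≠ u) (z : α → Bool) (hnot : ¬ (openGraph (labelledOpen ends z)).Reachable a u)
    {l : α} (hl : ∀ v ∈ ends l, v ∈ W ∨ v = u) :
    clusterFlip ends a (fun x => !z x) l = z l := by
  have hsepT := separates_compl ends u W hsep
  refine flat_apply_eq_self_of_not_reachable ends u {v : V | v ∉ W ∧ v ≠ u} hsepT (fun h => h.2 rfl) ⟨haW, hau⟩ z hnot ?_
  intro v hv
  rcases hl v hv with h | h
  · left
    simp only [Set.mem_setOf_eq, not_and, not_not]
    exact ⟨fun hn => absurd h hn, fun hvu => huW (hvu ▸ h)⟩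
  · exact Or.inr h

end OutsideFlat

/-! ### 2. Pointwise decompositions of `bad`, `P1`, `P2` across the network's cut vertex -/

section Pointwise

variable [DecidableEq V] (ends : α → Sym2 V) (u : V) (W : Set V)

/-- **`bad(s,a,c) = (Cn ∩ B) ⊔ (Vn ∩ Wt)` pointwise.**  With `s ∈ W`, `a, c ∉ W ∪ {u}`:
`[(a ↮ s ∧ a ↮ c ∧ s ↮ c) ∧ s ↔ c in ♭ₐz]` iff EITHER `u ↔ s` and `[(a ↮ u ∧ a ↮ c ∧ u ↮ c) ∧ u ↔ c in ♭ₐz]` (the apex is not joined to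
`u`; the flat at `a` leaves the network untouched) OR `[u ↮ s ∧ u ↔ s in ♭ᵤz]` and `[(a ↔ u ∧ a ↮ c) ∧ u ↔ c in ♭ₐz]` (the apex is joined
to `u`; then `♭ₐ = ♭ᵤ`, and the flat must re-join `s` to `u` inside the network and `u` to `c` outside). [this work] -/
theorem bad_iff_network
    (hsep : ∀ l : α, (∀ v ∈ ends l, v ∈ W ∨ v = u) ∨ (∀ v ∈ ends l, v ∉ W ∨ v = u)) (huW : u ∉ W)
    {a s c : V} (hs : s ∈ W) (haW : a ∉ W) (hau : a ≠ u) (hcW : c ∉ W) (z : α → Bool) :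
    ((¬ (openGraph (labelledOpen ends z)).Reachable a s ∧ ¬ (openGraph (labelledOpen ends z)).Reachable a c ∧
        ¬ (openGraph (labelledOpen ends z)).Reachable s c) ∧
      (openGraph (labelledOpen ends (clusterFlip ends a fun x => !z x))).Reachable s c) ↔
    (((openGraph (labelledOpen ends z)).Reachable u s ∧
        ((¬ (openGraph (labelledOpen ends z)).Reachable a u ∧ ¬ (openGraph (labelledOpen ends z)).Reachable a c ∧
            ¬ (openGraph (labelledOpen ends z)).Reachable u c) ∧
          (openGraph (labelledOpen ends (clusterFlip ends a fun x => !z x))).Reachable u c)) ∨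
      ((¬ (openGraph (labelledOpen ends z)).Reachable u s ∧
          (openGraph (labelledOpen ends (clusterFlip ends u fun x => !z x))).Reachable u s) ∧
        (((openGraph (labelledOpen ends z)).Reachable a u ∧ ¬ (openGraph (labelledOpen ends z)).Reachable a c) ∧
          (openGraph (labelledOpen ends (clusterFlip ends a fun x => !z x))).Reachable u c))) := by
  have cut_a := reachable_cut_iff ends u W hsep huW z hs haW
  have cut_c := reachable_cut_iff ends u W hsep huW z hs hcW
  have cut_c' := reachable_cut_iff ends u W hsep huW (clusterFlip ends a fun x => !z x) hs hcW
  constructor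
  · rintro ⟨⟨h1, h2, h3⟩, h4⟩
    obtain ⟨h4su, h4uc⟩ := cut_c'.1 h4
    by_cases hau' : (openGraph (labelledOpen ends z)).Reachable a u
    · -- the apex is joined to `u`: second alternative
      right
      have hus : ¬ (openGraph (labelledOpen ends z)).Reachable u s := fun h => h1 (hau'.trans h)
      have hflat := flat_eq_flat_of_reachable ends z hau'
      refine ⟨⟨hus, ?_⟩, ⟨hau', h2⟩, h4uc⟩
      rw [← hflat]; exact h4su.symm
    · -- the apex is not joined to `u`: the flat does not touch the network, so `u ↔ s` already in `z`
      left
      have hagree : ∀ l, (∀ v ∈ ends l, v ∈ W ∨ v = u) → ¬ (ends l).IsDiag →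
          clusterFlip ends a (fun x => !z x) l = z l :=
        fun l hl _ => flat_apply_eq_self_inside_of_not_reachable ends u W hsep huW haW hau z hau' hl
      have hus : (openGraph (labelledOpen ends z)).Reachable u s :=
        (reachable_iff_of_agree_inside ends u W hsep huW hagree (Or.inl hs)).1 h4su.symm
      refine ⟨hus, ⟨hau', h2, fun huc => h3 (hus.symm.trans huc)⟩, h4uc⟩
  · rintro (⟨hus, ⟨hau', hac, huc⟩, h4uc⟩ | ⟨⟨hus, hvs⟩, ⟨hau', hac⟩, h4uc⟩)
    · -- first alternative
      have hagree : ∀ l, (∀ v ∈ ends l, v ∈ W ∨ v = u) → ¬ (ends l).IsDiag →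
          z l = clusterFlip ends a (fun x => !z x) l :=
        fun l hl _ => (flat_apply_eq_self_inside_of_not_reachable ends u W hsep huW haW hau z hau' hl).symm
      have h4su : (openGraph (labelledOpen ends (clusterFlip ends a fun x => !z x))).Reachable u s :=
        (reachable_iff_of_agree_inside ends u W hsep huW hagree (Or.inl hs)).1 hus
      exact ⟨⟨fun has => hau' (cut_a.1 has.symm).2.symm, hac, fun hsc => huc (cut_c.1 hsc).2⟩, h4su.symm.trans h4uc⟩
    · -- second alternative
      have hflat := flat_eq_flat_of_reachable ends z hau'
      refine ⟨⟨fun has => hus (hau'.symm.trans has), hac, fun hsc => hus (cut_c.1 hsc).1.symm⟩, ?_⟩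
      have h4su : (openGraph (labelledOpen ends (clusterFlip ends a fun x => !z x))).Reachable s u := by
        rw [hflat]; exact hvs.symm
      exact h4su.trans h4uc

/-- **`{a ↔ s, a ↮ c} = Cn ∩ Q1` pointwise**: `a ↔ s ∧ a ↮ c` iff `u ↔ s` and `a ↔ u ∧ a ↮ c` (`s ∈ W`, `a ∉ W`). [this work] -/
theorem sa_iff_network
    (hsep : ∀ l : α, (∀ v ∈ ends l, v ∈ W ∨ v = u) ∨ (∀ v ∈ ends l, v ∉ W ∨ v = u)) (huW : u ∉ W)
    {a s c : V} (hs : s ∈ W) (haW : a ∉ W) (z : α → Bool) :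
    ((openGraph (labelledOpen ends z)).Reachable a s ∧ ¬ (openGraph (labelledOpen ends z)).Reachable a c) ↔
    ((openGraph (labelledOpen ends z)).Reachable u s ∧
      ((openGraph (labelledOpen ends z)).Reachable a u ∧ ¬ (openGraph (labelledOpen ends z)).Reachable a c)) := by
  have cut_a := reachable_cut_iff ends u W hsep huW z hs haW
  refine ⟨fun ⟨has, hac⟩ => ⟨(cut_a.1 has.symm).1.symm, (cut_a.1 has.symm).2.symm, hac⟩,
    fun ⟨hus, hau, hac⟩ => ⟨hau.trans hus, hac⟩⟩

/-- **`{a ↔ c, a ↮ s} = Q2 ⊔ (Dn ∩ J)` pointwise**: `a ↔ c ∧ a ↮ s` iff `a ↔ c ∧ a ↮ u`, or `u ↮ s` and `a ↔ c ∧ a ↔ u`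
(`s ∈ W`, `a ∉ W`). [this work] -/
theorem ac_iff_network
    (hsep : ∀ l : α, (∀ v ∈ ends l, v ∈ W ∨ v = u) ∨ (∀ v ∈ ends l, v ∉ W ∨ v = u)) (huW : u ∉ W)
    {a s c : V} (hs : s ∈ W) (haW : a ∉ W) (z : α → Bool) :
    ((openGraph (labelledOpen ends z)).Reachable a c ∧ ¬ (openGraph (labelledOpen ends z)).Reachable a s) ↔
    (((openGraph (labelledOpen ends z)).Reachable a c ∧ ¬ (openGraph (labelledOpen ends z)).Reachable a u) ∨
      (¬ (openGraph (labelledOpen ends z)).Reachable u s ∧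
        ((openGraph (labelledOpen ends z)).Reachable a c ∧ (openGraph (labelledOpen ends z)).Reachable a u))) := by
  have cut_a := reachable_cut_iff ends u W hsep huW z hs haW
  constructor
  · rintro ⟨hac, has⟩
    by_cases hau : (openGraph (labelledOpen ends z)).Reachable a u
    · exact Or.inr ⟨fun hus => has (hau.trans hus), hac, hau⟩
    · exact Or.inl ⟨hac, hau⟩
  · rintro (⟨hac, hau⟩ | ⟨hus, hac, hau⟩)
    · exact ⟨hac, fun has => hau (cut_a.1 has.symm).2.symm⟩
    · exact ⟨hac, fun has => hus (hau.symm.trans has)⟩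

end Pointwise

/-! ### 3. The arithmetic of the gluing -/

/-- **The gluing arithmetic.**  From `B² ≤ Q1·Q2` (the far side's `(P)`), `(B + Wt)² ≤ Q1·(2·Q2 + J)` (its pendant-edge form) and the
two-point facts `Vn ≤ Cn`, `Vn ≤ Dn`:  `(Cn·B + Vn·Wt)² ≤ Cn·Q1·(Q2·(Cn + Dn) + Dn·J)`.  The left side increases with `Vn`; for
`Cn ≤ Dn` put `Vn = Cn` and use the second hypothesis; for `Dn ≤ Cn` put `Vn = Dn`, `Cn = Dn + E`, and use the identity
`((Dn+E)·B + Dn·Wt)² + Dn·E·Wt² = (Dn+E)·(E·B² + Dn·(B+Wt)²)`. [this work] -/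
theorem network_arith (B Wt Q1 Q2 J Cn Dn Vn : ℕ) (h1 : B ^ 2 ≤ Q1 * Q2) (h2 : (B + Wt) ^ 2 ≤ Q1 * (2 * Q2 + J))
    (hVC : Vn ≤ Cn) (hVD : Vn ≤ Dn) :
    (Cn * B + Vn * Wt) ^ 2 ≤ Cn * Q1 * (Q2 * (Cn + Dn) + Dn * J) := by
  rcases le_total Cn Dn with hCD | hDC
  · have hle : Cn * B + Vn * Wt ≤ Cn * (B + Wt) := by
      rw [Nat.mul_add]; exact Nat.add_le_add_left (Nat.mul_le_mul_right _ hVC) _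
    have h3 : Cn * (2 * Q2 + J) ≤ Q2 * (Cn + Dn) + Dn * J := by
      have e1 : Q2 * Cn ≤ Q2 * Dn := Nat.mul_le_mul_left _ hCD
      have e2 : Cn * J ≤ Dn * J := Nat.mul_le_mul_right _ hCD
      calc Cn * (2 * Q2 + J) = Q2 * Cn + Q2 * Cn + Cn * J := by ring
        _ ≤ Q2 * Cn + Q2 * Dn + Dn * J := Nat.add_le_add (Nat.add_le_add_left e1 _) e2
        _ = Q2 * (Cn + Dn) + Dn * J := by ring
    calc (Cn * B + Vn * Wt) ^ 2 ≤ (Cn * (B + Wt)) ^ 2 := Nat.pow_le_pow_left hle 2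
      _ = Cn * (Cn * (B + Wt) ^ 2) := by ring
      _ ≤ Cn * (Cn * (Q1 * (2 * Q2 + J))) := Nat.mul_le_mul_left _ (Nat.mul_le_mul_left _ h2)
      _ = Cn * Q1 * (Cn * (2 * Q2 + J)) := by ring
      _ ≤ Cn * Q1 * (Q2 * (Cn + Dn) + Dn * J) := Nat.mul_le_mul_left _ h3
  · obtain ⟨E, rfl⟩ := Nat.exists_eq_add_of_le hDC
    have hle : (Dn + E) * B + Vn * Wt ≤ (Dn + E) * B + Dn * Wt :=
      Nat.add_le_add_left (Nat.mul_le_mul_right _ hVD) _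
    have hid : ((Dn + E) * B + Dn * Wt) ^ 2 + Dn * E * Wt ^ 2 = (Dn + E) * (E * B ^ 2 + Dn * (B + Wt) ^ 2) := by ring
    calc ((Dn + E) * B + Vn * Wt) ^ 2 ≤ ((Dn + E) * B + Dn * Wt) ^ 2 := Nat.pow_le_pow_left hle 2
      _ ≤ ((Dn + E) * B + Dn * Wt) ^ 2 + Dn * E * Wt ^ 2 := Nat.le_add_right _ _
      _ = (Dn + E) * (E * B ^ 2 + Dn * (B + Wt) ^ 2) := hid
      _ ≤ (Dn + E) * (E * (Q1 * Q2) + Dn * (Q1 * (2 * Q2 + J))) :=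
          Nat.mul_le_mul_left _ (Nat.add_le_add (Nat.mul_le_mul_left _ h1) (Nat.mul_le_mul_left _ h2))
      _ = (Dn + E) * Q1 * (Q2 * (Dn + E + Dn) + Dn * J) := by ring

/-! ### 4. Reduction R3: a two-terminal network at the terminal `s` -/

section Network

variable [Fintype α] [DecidableEq α] [DecidableEq V]

open Classical in
/-- **A TWO-TERMINAL NETWORK HUNG AT A TERMINAL (reduction R3).**  On a finite multigraph `(V, α, ends)` let the cut vertex `u ∉ W` separate the
network side `W ∋ s` from the rest (every label inside `W ∪ {u}` or inside `Wᶜ ∪ {u}`), with `a, c ∉ W ∪ {u}`.  Write, for the far-side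
terminals `(u, a, c)` with apex `a`:  `B = {a ↮ u, a ↮ c, u ↮ c in z, u ↔ c in ♭ₐz}`, `Q1 = {a ↔ u, a ↮ c}`, `Q2 = {a ↔ c, a ↮ u}`,
`J = {a ↔ c, a ↔ u}`, `Wt = {a ↔ u, a ↮ c in z, u ↔ c in ♭ₐz}`.  If `#B² ≤ #Q1·#Q2` (`(P)` for `(u, a, c)`) and `(#B + #Wt)² ≤ #Q1·(2·#Q2 + #J)`
(`(P)` for the far side with a pendant label at `u` as terminal), then `(P)` holds for `(s, a, c)`:
`#{a ↮ s, a ↮ c, s ↮ c in z, s ↔ c in ♭ₐz}² ≤ #{a ↔ s, a ↮ c}·#{a ↔ c, a ↮ s}` — whatever the network `W`. [this work] -/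
theorem productForm_of_terminalNetwork (ends : α → Sym2 V) (u a s c : V) (W : Set V)
    (hsep : ∀ l : α, (∀ v ∈ ends l, v ∈ W ∨ v = u) ∨ (∀ v ∈ ends l, v ∉ W ∨ v = u))
    (huW : u ∉ W) (hs : s ∈ W) (haW : a ∉ W) (hau : a ≠ u) (hcW : c ∉ W) (hcu : c ≠ u)
    (h1 : (univ.filter fun z : α → Bool =>
        (¬ (openGraph (labelledOpen ends z)).Reachable a u ∧ ¬ (openGraph (labelledOpen ends z)).Reachable a c ∧
            ¬ (openGraph (labelledOpen ends z)).Reachable u c) ∧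
          (openGraph (labelledOpen ends (clusterFlip ends a fun x => !z x))).Reachable u c).card ^ 2 ≤
      (univ.filter fun z : α → Bool =>
        (openGraph (labelledOpen ends z)).Reachable a u ∧ ¬ (openGraph (labelledOpen ends z)).Reachable a c).card *
      (univ.filter fun z : α → Bool =>
        (openGraph (labelledOpen ends z)).Reachable a c ∧ ¬ (openGraph (labelledOpen ends z)).Reachable a u).card)
    (h2 : ((univ.filter fun z : α → Bool =>
        (¬ (openGraph (labelledOpen ends z)).Reachable a u ∧ ¬ (openGraph (labelledOpen ends z)).Reachable a c ∧
            ¬ (openGraph (labelledOpen ends z)).Reachable u c) ∧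
          (openGraph (labelledOpen ends (clusterFlip ends a fun x => !z x))).Reachable u c).card +
        (univ.filter fun z : α → Bool =>
          ((openGraph (labelledOpen ends z)).Reachable a u ∧ ¬ (openGraph (labelledOpen ends z)).Reachable a c) ∧
            (openGraph (labelledOpen ends (clusterFlip ends a fun x => !z x))).Reachable u c).card) ^ 2 ≤
      (univ.filter fun z : α → Bool =>
        (openGraph (labelledOpen ends z)).Reachable a u ∧ ¬ (openGraph (labelledOpen ends z)).Reachable a c).card *
      (2 * (univ.filter fun z : α → Bool =>
        (openGraph (labelledOpen ends z)).Reachable a c ∧ ¬ (openGraph (labelledOpen ends z)).Reachable a u).card +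
        (univ.filter fun z : α → Bool =>
          (openGraph (labelledOpen ends z)).Reachable a c ∧ (openGraph (labelledOpen ends z)).Reachable a u).card)) :
    (univ.filter fun z : α → Bool =>
        (¬ (openGraph (labelledOpen ends z)).Reachable a s ∧ ¬ (openGraph (labelledOpen ends z)).Reachable a c ∧
          ¬ (openGraph (labelledOpen ends z)).Reachable s c) ∧
        (openGraph (labelledOpen ends (clusterFlip ends a fun x => !z x))).Reachable s c).card ^ 2 ≤
    (univ.filter fun z : α → Bool =>
        (openGraph (labelledOpen ends z)).Reachable a s ∧ ¬ (openGraph (labelledOpen ends z)).Reachable a c).card *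
    (univ.filter fun z : α → Bool =>
        (openGraph (labelledOpen ends z)).Reachable a c ∧ ¬ (openGraph (labelledOpen ends z)).Reachable a s).card := by
  set T : Set V := {v : V | v ∉ W ∧ v ≠ u} with hT
  have hsepT := separates_compl ends u W hsep
  have huT : u ∉ T := fun h => h.2 rfl
  have haT : a ∈ T ∨ a = u := Or.inl ⟨haW, hau⟩
  have hcT : c ∈ T ∨ c = u := Or.inl ⟨hcW, hcu⟩
  have huT' : u ∈ T ∨ u = u := Or.inr rfl
  let ins : α → Prop := fun l => (∀ v ∈ ends l, v ∈ W ∨ v = u) ∧ ¬ (ends l).IsDiag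
  have hagW : ∀ z z' : α → Bool, (∀ l, ins l → z l = z' l) →
      ∀ l, (∀ v ∈ ends l, v ∈ W ∨ v = u) → ¬ (ends l).IsDiag → z l = z' l :=
    fun z z' h l hl hd => h l ⟨hl, hd⟩
  have hagT : ∀ z z' : α → Bool, (∀ l, ¬ ins l → z l = z' l) →
      ∀ l, (∀ v ∈ ends l, v ∈ T ∨ v = u) → ¬ (ends l).IsDiag → z l = z' l := by
    intro z z' h l hl hd
    refine h l fun hins => hd (isDiag_of_forall_eq (a := u) fun v hv => ?_)
    rcases hins.1 v hv with h1 | h1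
    · rcases hl v hv with h2 | h2
      · exact absurd h1 h2.1
      · exact h2
    · exact h1
  have hR_in : ∀ z z' : α → Bool, (∀ l, ins l → z l = z' l) →
      ((openGraph (labelledOpen ends z)).Reachable u s ↔ (openGraph (labelledOpen ends z')).Reachable u s) :=
    fun z z' h => reachable_iff_of_agree_inside ends u W hsep huW (hagW z z' h) (Or.inl hs)
  have hV_in : ∀ z z' : α → Bool, (∀ l, ins l → z l = z' l) →
      (¬ (openGraph (labelledOpen ends z)).Reachable u s ∧
          (openGraph (labelledOpen ends (clusterFlip ends u fun x => !z x))).Reachable u s) →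
      (¬ (openGraph (labelledOpen ends z')).Reachable u s ∧
          (openGraph (labelledOpen ends (clusterFlip ends u fun x => !z' x))).Reachable u s) :=
    fun z z' h hz => (virtual_iff_of_agree ends u W hsep huW (hagW z z' h) (Or.inl hs)).1 hz
  have hR_out : ∀ z z' : α → Bool, (∀ l, ¬ ins l → z l = z' l) → ∀ {x y : V}, (x ∈ T ∨ x = u) → (y ∈ T ∨ y = u) →
      ((openGraph (labelledOpen ends z)).Reachable x y ↔ (openGraph (labelledOpen ends z')).Reachable x y) :=
    fun z z' h x y hx hy => reachable_iff_of_agree_outside ends u W hsep huW (hagT z z' h) hx hy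
  have hF_out : ∀ z z' : α → Bool, (∀ l, ¬ ins l → z l = z' l) →
      ((openGraph (labelledOpen ends (clusterFlip ends a fun x => !z x))).Reachable u c ↔
        (openGraph (labelledOpen ends (clusterFlip ends a fun x => !z' x))).Reachable u c) :=
    fun z z' h => reachable_iff_of_agree_outside ends u W hsep huW
      (fun l hl hd => flat_apply_eq_of_agree_outside ends u W hsep huW (hagT z z' h) haT hl hd) huT' hcT
  have ebad := Finset.filter_congr (s := (univ : Finset (α → Bool)))
    fun z _ => bad_iff_network ends u W hsep huW hs haW hau hcW z
  have eP1 := Finset.filter_congr (s := (univ : Finset (α → Bool)))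
    fun z _ => sa_iff_network ends u W hsep huW (c := c) hs haW z
  have eP2 := Finset.filter_congr (s := (univ : Finset (α → Bool)))
    fun z _ => ac_iff_network ends u W hsep huW (c := c) hs haW z
  rw [ebad, eP1, eP2, Finset.filter_or, Finset.filter_or]
  have hdisj1 : Disjoint
      (univ.filter fun z : α → Bool => (openGraph (labelledOpen ends z)).Reachable u s ∧
        ((¬ (openGraph (labelledOpen ends z)).Reachable a u ∧ ¬ (openGraph (labelledOpen ends z)).Reachable a c ∧
            ¬ (openGraph (labelledOpen ends z)).Reachable u c) ∧
          (openGraph (labelledOpen ends (clusterFlip ends a fun x => !z x))).Reachable u c))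
      (univ.filter fun z : α → Bool => (¬ (openGraph (labelledOpen ends z)).Reachable u s ∧
          (openGraph (labelledOpen ends (clusterFlip ends u fun x => !z x))).Reachable u s) ∧
        (((openGraph (labelledOpen ends z)).Reachable a u ∧ ¬ (openGraph (labelledOpen ends z)).Reachable a c) ∧
          (openGraph (labelledOpen ends (clusterFlip ends a fun x => !z x))).Reachable u c)) := by
    rw [Finset.disjoint_filter]; intro z _ h h'; exact h'.1.1 h.1
  have hdisj2 : Disjoint
      (univ.filter fun z : α → Bool =>
        (openGraph (labelledOpen ends z)).Reachable a c ∧ ¬ (openGraph (labelledOpen ends z)).Reachable a u)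
      (univ.filter fun z : α → Bool => ¬ (openGraph (labelledOpen ends z)).Reachable u s ∧
        ((openGraph (labelledOpen ends z)).Reachable a c ∧ (openGraph (labelledOpen ends z)).Reachable a u)) := by
    rw [Finset.disjoint_filter]; intro z _ h h'; exact h.2 h'.2.2
  rw [Finset.card_union_of_disjoint hdisj1, Finset.card_union_of_disjoint hdisj2]
  have hI1 := card_and_mul_card_univ ins
    (fun z => (openGraph (labelledOpen ends z)).Reachable u s)
    (fun z => (¬ (openGraph (labelledOpen ends z)).Reachable a u ∧ ¬ (openGraph (labelledOpen ends z)).Reachable a c ∧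
          ¬ (openGraph (labelledOpen ends z)).Reachable u c) ∧
        (openGraph (labelledOpen ends (clusterFlip ends a fun x => !z x))).Reachable u c)
    (fun z z' h hz => (hR_in z z' h).1 hz)
    (by
      rintro z z' h ⟨⟨e1, e2, e3⟩, e4⟩
      exact ⟨⟨fun h' => e1 ((hR_out z z' h haT huT').2 h'), fun h' => e2 ((hR_out z z' h haT hcT).2 h'),
        fun h' => e3 ((hR_out z z' h huT' hcT).2 h')⟩, (hF_out z z' h).1 e4⟩)
  have hI2 := card_and_mul_card_univ ins
    (fun z => ¬ (openGraph (labelledOpen ends z)).Reachable u s ∧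
          (openGraph (labelledOpen ends (clusterFlip ends u fun x => !z x))).Reachable u s)
    (fun z => ((openGraph (labelledOpen ends z)).Reachable a u ∧ ¬ (openGraph (labelledOpen ends z)).Reachable a c) ∧
          (openGraph (labelledOpen ends (clusterFlip ends a fun x => !z x))).Reachable u c)
    hV_in
    (by
      rintro z z' h ⟨⟨e1, e2⟩, e4⟩
      exact ⟨⟨(hR_out z z' h haT huT').1 e1, fun h' => e2 ((hR_out z z' h haT hcT).2 h')⟩, (hF_out z z' h).1 e4⟩)
  have hI3 := card_and_mul_card_univ ins
    (fun z => (openGraph (labelledOpen ends z)).Reachable u s)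
    (fun z => (openGraph (labelledOpen ends z)).Reachable a u ∧ ¬ (openGraph (labelledOpen ends z)).Reachable a c)
    (fun z z' h hz => (hR_in z z' h).1 hz)
    (by
      rintro z z' h ⟨e1, e2⟩
      exact ⟨(hR_out z z' h haT huT').1 e1, fun h' => e2 ((hR_out z z' h haT hcT).2 h')⟩)
  have hI4 := card_and_mul_card_univ ins
    (fun z => ¬ (openGraph (labelledOpen ends z)).Reachable u s)
    (fun z => (openGraph (labelledOpen ends z)).Reachable a c ∧ (openGraph (labelledOpen ends z)).Reachable a u)
    (fun z z' h hz => fun h' => hz ((hR_in z z' h).2 h'))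
    (by
      rintro z z' h ⟨e1, e2⟩
      exact ⟨(hR_out z z' h haT hcT).1 e1, (hR_out z z' h haT huT').1 e2⟩)
  beta_reduce at hI1 hI2 hI3 hI4
  have hVC := card_virtual_le_card_conn ends u s
  have hVD := card_virtual_le_card_disc ends u s
  have hU : (univ.filter fun z : α → Bool => (openGraph (labelledOpen ends z)).Reachable u s).card +
      (univ.filter fun z : α → Bool => ¬ (openGraph (labelledOpen ends z)).Reachable u s).card =
      (univ : Finset (α → Bool)).card :=
    Finset.card_filter_add_card_filter_not _
  set U := (univ : Finset (α → Bool)).card with hUdef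
  set Cn := (univ.filter fun z : α → Bool => (openGraph (labelledOpen ends z)).Reachable u s).card with hCn
  set Dn := (univ.filter fun z : α → Bool => ¬ (openGraph (labelledOpen ends z)).Reachable u s).card with hDn
  set Vn := (univ.filter fun z : α → Bool => ¬ (openGraph (labelledOpen ends z)).Reachable u s ∧
          (openGraph (labelledOpen ends (clusterFlip ends u fun x => !z x))).Reachable u s).card with hVn
  set B := (univ.filter fun z : α → Bool =>
        (¬ (openGraph (labelledOpen ends z)).Reachable a u ∧ ¬ (openGraph (labelledOpen ends z)).Reachable a c ∧
            ¬ (openGraph (labelledOpen ends z)).Reachable u c) ∧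
          (openGraph (labelledOpen ends (clusterFlip ends a fun x => !z x))).Reachable u c).card with hB
  set Wt := (univ.filter fun z : α → Bool =>
          ((openGraph (labelledOpen ends z)).Reachable a u ∧ ¬ (openGraph (labelledOpen ends z)).Reachable a c) ∧
            (openGraph (labelledOpen ends (clusterFlip ends a fun x => !z x))).Reachable u c).card with hWt
  set Q1 := (univ.filter fun z : α → Bool =>
        (openGraph (labelledOpen ends z)).Reachable a u ∧ ¬ (openGraph (labelledOpen ends z)).Reachable a c).card with hQ1
  set Q2 := (univ.filter fun z : α → Bool =>
        (openGraph (labelledOpen ends z)).Reachable a c ∧ ¬ (openGraph (labelledOpen ends z)).Reachable a u).card with hQ2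
  set Jn := (univ.filter fun z : α → Bool =>
          (openGraph (labelledOpen ends z)).Reachable a c ∧ (openGraph (labelledOpen ends z)).Reachable a u).card with hJn
  set X1 := (univ.filter fun z : α → Bool => (openGraph (labelledOpen ends z)).Reachable u s ∧
        ((¬ (openGraph (labelledOpen ends z)).Reachable a u ∧ ¬ (openGraph (labelledOpen ends z)).Reachable a c ∧
            ¬ (openGraph (labelledOpen ends z)).Reachable u c) ∧
          (openGraph (labelledOpen ends (clusterFlip ends a fun x => !z x))).Reachable u c)).card with hX1
  set X2 := (univ.filter fun z : α → Bool => (¬ (openGraph (labelledOpen ends z)).Reachable u s ∧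
          (openGraph (labelledOpen ends (clusterFlip ends u fun x => !z x))).Reachable u s) ∧
        (((openGraph (labelledOpen ends z)).Reachable a u ∧ ¬ (openGraph (labelledOpen ends z)).Reachable a c) ∧
          (openGraph (labelledOpen ends (clusterFlip ends a fun x => !z x))).Reachable u c)).card with hX2
  set Y1 := (univ.filter fun z : α → Bool => (openGraph (labelledOpen ends z)).Reachable u s ∧
        ((openGraph (labelledOpen ends z)).Reachable a u ∧ ¬ (openGraph (labelledOpen ends z)).Reachable a c)).card with hY1
  set Y2 := (univ.filter fun z : α → Bool => ¬ (openGraph (labelledOpen ends z)).Reachable u s ∧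
        ((openGraph (labelledOpen ends z)).Reachable a c ∧ (openGraph (labelledOpen ends z)).Reachable a u)).card with hY2
  have hUpos : 0 < U := Finset.card_pos.mpr Finset.univ_nonempty
  have harith := network_arith B Wt Q1 Q2 Jn Cn Dn Vn h1 h2 hVC hVD
  have key : (X1 + X2) * U * ((X1 + X2) * U) ≤ Y1 * U * ((Q2 + Y2) * U) := by
    have eL : (X1 + X2) * U = Cn * B + Vn * Wt := by rw [Nat.add_mul, hI1, hI2]
    have eR1 : Y1 * U = Cn * Q1 := hI3
    have eR2 : (Q2 + Y2) * U = Q2 * (Cn + Dn) + Dn * Jn := by rw [Nat.add_mul, hI4, hU]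
    rw [eL, eR1, eR2]
    calc (Cn * B + Vn * Wt) * (Cn * B + Vn * Wt) = (Cn * B + Vn * Wt) ^ 2 := (sq _).symm
      _ ≤ Cn * Q1 * (Q2 * (Cn + Dn) + Dn * Jn) := harith
  have key' : (X1 + X2) ^ 2 * (U * U) ≤ Y1 * (Q2 + Y2) * (U * U) := by
    calc (X1 + X2) ^ 2 * (U * U) = (X1 + X2) * U * ((X1 + X2) * U) := by ring
      _ ≤ Y1 * U * ((Q2 + Y2) * U) := key
      _ = Y1 * (Q2 + Y2) * (U * U) := by ring
  exact Nat.le_of_mul_le_mul_right key' (Nat.mul_pos hUpos hUpos)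

end Network

end Summit.CriticalPhenomena.PercolationContinuityZ3.Theorems.ProductFormFibre
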